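import Mathlib
import Literature.Barriers.NavierStokesRegularity.DyadicCascadePositivity
import Literature.Barriers.NavierStokesRegularity.DyadicInvariantRegionScaling
import Literature.Analysis.ODE.OneSidedComparison
import HarnessLib

/-!
# Smoothing of positive solutions of the dyadic model from a supercritical decay bound
  (BMR 2011, proof of Thm. 1, §3.2: "good" times from the energy inequality, and the bootstrap)

Barrier catalogue `Literature/Barriers/NavierStokesRegularity/`, proof file towards the named fact
`Dyadic.BarbatoMorandinRomito2011_thm1` (`DyadicCascadeRegularity`). Two steps of the proof of
Theorem 1 of Barbato–Morandin–Romito 2011 (§3.2, pp. 7–8 of the arXiv text) for a non-negative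
weak solution `X` of (1.1) with `ℓ²` datum (`IsBMRWeakSolution`, positivity and energy from
`DyadicCascadePositivity`):

* `exists_goodTime` — "By the energy inequality, `∑ₙ∫₀ᵗ(λₙXₙ(s))²ds < ∞`, hence
  `supₙ(λₙXₙ(t)) < ∞` for a.e. `t > 0`. Let `t₀ > 0` be one of these times": for every `T > 0`
  there is `t₀ ∈ [T/2, T]` with `∑_{n≤N} λₙ²Xₙ(t₀)² ≤ B` for all `N` (no measure theory: a
  Chebyshev point `ξ_N` of each partial sum on `[T/2, T]`, a limit point of `(ξ_N)`, and the
  monotonicity of the partial sums in `N`).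
* `exists_rpow_mul_le_of_decay` — the smoothing bootstrap replacing BMR's second claim (their
  `Vₙ = Xₙe^{νλₙ(t-t₀)}`, comparison and Banach fixed point, Prop. 3.3 and Remark 3.4): if
  `λₙ^q Xₙ(t) ≤ K` for all `n ≥ 1`, `t ≥ s₀`, with `q > β - 2`, then for every `γ > 0` and
  `t > s₀`, `supₙ λₙ^γ Xₙ(t) < ∞`. One step (`decay_step`, the Duhamel bound of the proof of
  Prop. 3.3 with the negative transport term dropped thanks to positivity):
  `Xₙ' ≤ -νλₙ²Xₙ + λ_{n-1}^β (Kλ_{n-1}^{-q})²` on `[s₀, ∞)` gives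
  `Xₙ(t) ≤ M e^{-νλₙ²(t-s₀)} + K²λ_{n-1}^{β-2q}/(νλₙ²)`, i.e. the exponent improves from `q` to
  `2q + 2 - β = q + (q - (β - 2))`; iterating, the gain per step is at least `q₀ - (β - 2) > 0`.

Theorem-only module.

## References

* D. Barbato, F. Morandin, M. Romito, *Smooth solutions for the dyadic model*, Nonlinearity 24
  (2011) 3083–3097, §3.1 Prop. 3.3 (proof: the mild formulation and the recursive bound for
  `Gₙ = sup λₙ^γ|Xₙ|`), §3.2 proof of Thm. 1 (arXiv:1007.3401, pp. 6–8). [`BarbatoMorandinRomito2011`]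
-/

noncomputable section

open Set Filter Topology MeasureTheory intervalIntegral

namespace Literature.Barriers.NavierStokesRegularity.Dyadic

section

variable {ν β : ℝ} {x : ℕ → ℝ} {X : ℕ → ℝ → ℝ}

/-! ## Good times -/

/-- **A good time in every interval** (BMR §3.2: "hence `supₙ(λₙXₙ(t)) < ∞` for a. e. `t > 0`.
Let `t₀ > 0` be one of these times"). For a weak solution with non-negative `ℓ²` datum, `ν > 0`,
`β ≠ 0`, and every `T > 0` there are `t₀ ∈ [T/2, T]` and `B` with `∑_{n≤N} λₙ² Xₙ(t₀)² ≤ B` for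
all `N`. Proof: `∫₀ᵀ ∑_{n≤N} λₙ²Xₙ² ≤ ∑xₙ²/(2ν)` uniformly in `N` (energy inequality), so each
partial sum is `≤ B` somewhere on `[T/2, T]`; a limit point of these points works for every `N`
because the partial sums increase with `N` and are continuous.
[cite: BarbatoMorandinRomito2011, §3.2 (proof of Thm. 1, first claim)] -/
theorem IsBMRWeakSolution.exists_goodTime (hX : IsBMRWeakSolution ν β x X) (hν : 0 < ν) (hβ : β ≠ 0)
    (hx : ∀ n, 1 ≤ n → 0 ≤ x n) (hx2 : Summable fun n => x n ^ 2) {T : ℝ} (hT : 0 < T) :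
    ∃ t₀ ∈ Icc (T / 2) T, ∃ B : ℝ, ∀ N,
      ∑ m ∈ Finset.range N, bmrLambda (m + 1) ^ 2 * X (m + 1) t₀ ^ 2 ≤ B := by
  set S : ℝ := ∑' n, x n ^ 2 with hS
  set f : ℕ → ℝ → ℝ := fun N t => ∑ m ∈ Finset.range N, bmrLambda (m + 1) ^ 2 * X (m + 1) t ^ 2
    with hf
  have hfc : ∀ N, ContinuousOn (f N) (Ici 0) := fun N =>
    continuousOn_finsetSum _ fun m _ => continuousOn_const.mul ((hX.continuousOn (by omega)).pow 2)
  have hf0 : ∀ N t, 0 ≤ f N t := fun N t => Finset.sum_nonneg fun m _ => by positivity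
  have hfmono : ∀ M N, M ≤ N → ∀ t, f M t ≤ f N t := fun M N hMN t =>
    Finset.sum_le_sum_of_subset_of_nonneg (Finset.range_mono hMN) fun m _ _ => by positivity
  -- the dissipation bound `∫₀ᵀ f N ≤ S / (2ν)`
  have hint : ∀ N, ∫ t in (0 : ℝ)..T, f N t ≤ S / (2 * ν) := by
    intro N
    have h := hX.sum_integral_dissipation_le hβ hx hx2 N hT.le
    have heq : ∫ t in (0 : ℝ)..T, f N t =
        ∑ m ∈ Finset.range N, ∫ t in (0 : ℝ)..T, bmrLambda (m + 1) ^ 2 * X (m + 1) t ^ 2 := by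
      rw [hf]
      exact intervalIntegral.integral_finsetSum fun m _ =>
        ((continuousOn_const.mul ((hX.continuousOn (by omega)).pow 2)).mono
          Icc_subset_Ici_self).intervalIntegrable_of_Icc hT.le
    rw [heq, le_div_iff₀ (by positivity)]
    linarith
  -- Chebyshev points on `[T/2, T]`
  set B : ℝ := S / (2 * ν) * (2 / T) + 1 with hB
  have hcheb : ∀ N, ∃ ξ ∈ Icc (T / 2) T, f N ξ ≤ B := by
    intro N
    by_contra hcon
    push Not at hcon
    have hfi : IntervalIntegrable (f N) volume (T / 2) T :=
      ((hfc N).mono (fun t ht => (show (0 : ℝ) ≤ T / 2 by positivity).trans ht.1)).intervalIntegrable_of_Icc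
        (by linarith)
    have h1 : ∫ t in (T / 2)..T, B ≤ ∫ t in (T / 2)..T, f N t :=
      intervalIntegral.integral_mono_on (by linarith) (by simp) hfi fun t ht => (hcon t ht).le
    have h2 : ∫ t in (T / 2)..T, f N t ≤ ∫ t in (0 : ℝ)..T, f N t := by
      have hfi0 : IntervalIntegrable (f N) volume 0 (T / 2) :=
        ((hfc N).mono Icc_subset_Ici_self).intervalIntegrable_of_Icc (by positivity)
      rw [← intervalIntegral.integral_add_adjacent_intervals hfi0 hfi]
      have : 0 ≤ ∫ t in (0 : ℝ)..(T / 2), f N t :=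
        intervalIntegral.integral_nonneg (by positivity) fun t _ => hf0 N t
      linarith
    rw [intervalIntegral.integral_const, smul_eq_mul] at h1
    have h3 : (T - T / 2) * B = S / (2 * ν) + T / 2 := by rw [hB]; field_simp; ring
    linarith [hint N]
  choose ξ hξmem hξle using hcheb
  -- a limit point of the Chebyshev points
  obtain ⟨t₀, ht₀mem, ψ, hψ, hlim⟩ := isCompact_Icc.tendsto_subseq hξmem
  refine ⟨t₀, ht₀mem, B, fun N => ?_⟩
  have ht₀0 : 0 ≤ t₀ := (show (0 : ℝ) ≤ T / 2 by positivity).trans ht₀mem.1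
  -- `f N (ξ (ψ k)) ≤ B` eventually, and `f N` is continuous at `t₀` within `[0, ∞)`
  have hev : ∀ᶠ k in atTop, f N (ξ (ψ k)) ≤ B := by
    filter_upwards [eventually_ge_atTop N] with k hk
    exact (hfmono N (ψ k) (hk.trans (hψ.id_le k)) _).trans (hξle (ψ k))
  have hlim' : Tendsto (fun k => ξ (ψ k)) atTop (𝓝[Ici 0] t₀) :=
    tendsto_nhdsWithin_iff.2 ⟨hlim, Eventually.of_forall fun k =>
      (show (0 : ℝ) ≤ T / 2 by positivity).trans (hξmem (ψ k)).1⟩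
  have hcomp : Tendsto (fun k => f N (ξ (ψ k))) atTop (𝓝 (f N t₀)) :=
    ((hfc N) t₀ ht₀0).tendsto.comp hlim'
  exact le_of_tendsto hcomp hev

/-! ## The smoothing bootstrap -/

/-- Gaussian decay beats any power: for `y ≥ 1`, `c > 0`, `0 ≤ q ≤ m`,
`y^q e^{-cy²} ≤ m!/c^m` (from `(cy²)^m/m! ≤ e^{cy²}`). [folklore] -/
theorem rpow_mul_exp_neg_le {y c q : ℝ} {m : ℕ} (hy : 1 ≤ y) (hc : 0 < c) (hq : q ≤ m) :
    y ^ q * Real.exp (-(c * y ^ 2)) ≤ (m.factorial : ℝ) / c ^ m := by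
  have hy0 : 0 < y := by linarith
  have h1 : y ^ q ≤ y ^ (m : ℝ) := Real.rpow_le_rpow_of_exponent_le hy hq
  have h2 : y ^ (m : ℝ) ≤ (y ^ 2) ^ m := by
    rw [Real.rpow_natCast, ← pow_mul]
    exact pow_le_pow_right₀ hy (by omega)
  have h3 : (c * y ^ 2) ^ m / m.factorial ≤ Real.exp (c * y ^ 2) :=
    Real.pow_div_factorial_le_exp _ (by positivity) m
  have hfac : (0 : ℝ) < m.factorial := by exact_mod_cast Nat.factorial_pos m
  have h4 : (y ^ 2) ^ m ≤ (m.factorial : ℝ) / c ^ m * Real.exp (c * y ^ 2) := by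
    rw [mul_pow] at h3
    rw [div_mul_eq_mul_div, le_div_iff₀ (by positivity)]
    rw [div_le_iff₀ hfac] at h3
    nlinarith [h3]
  have hexp : 0 < Real.exp (-(c * y ^ 2)) := Real.exp_pos _
  calc y ^ q * Real.exp (-(c * y ^ 2)) ≤ (y ^ 2) ^ m * Real.exp (-(c * y ^ 2)) :=
        mul_le_mul_of_nonneg_right (h1.trans h2) hexp.le
    _ ≤ (m.factorial : ℝ) / c ^ m * Real.exp (c * y ^ 2) * Real.exp (-(c * y ^ 2)) :=
        mul_le_mul_of_nonneg_right h4 hexp.le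
    _ = (m.factorial : ℝ) / c ^ m := by
        rw [mul_assoc, ← Real.exp_add, add_neg_cancel, Real.exp_zero, mul_one]

/-- The exponent bookkeeping of one bootstrap step: for `n ≥ 2`,
`λₙ^{2q+2-β} λ_{n-1}^β (λ_{n-1}^{-q})² · 4 = 2^{2q+2-β} λₙ²`. [folklore] -/
theorem bootstrap_weights (q β : ℝ) (k : ℕ) :
    bmrLambda (k + 2) ^ (2 * q + 2 - β) * bmrLambda (k + 1) ^ β * (bmrLambda (k + 1) ^ (-q)) ^ 2 * 4 =
      (2 : ℝ) ^ (2 * q + 2 - β) * bmrLambda (k + 2) ^ 2 := by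
  have h4 : (4 : ℝ) = (2 : ℝ) ^ (2 : ℝ) := by norm_num
  rw [bmrLambda_rpow_eq (by omega), bmrLambda_rpow_eq (by omega), bmrLambda_rpow_eq (by omega),
    bmrLambda_sq_eq (by omega), sq, h4, two_rpow_mul_two_rpow, two_rpow_mul_two_rpow,
    two_rpow_mul_two_rpow, two_rpow_mul_two_rpow, two_rpow_mul_two_rpow]
  congr 1; push_cast; ring

/-- **One smoothing step** (the recursive bound in the proof of BMR Prop. 3.3, for positive
solutions). Let `X` be a weak solution with non-negative `ℓ²` datum, `ν > 0`, `β > 0`, and suppose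
`λₙ^q Xₙ(t) ≤ K` for all `n ≥ 1`, `t ≥ s₀`. Then for every `s₁ > s₀`
there is `K'` with `λₙ^{2q+2-β} Xₙ(t) ≤ K'` for all `n ≥ 1`, `t ≥ s₁`: by positivity
`Xₙ' ≤ -νλₙ²Xₙ + λ_{n-1}^β(Kλ_{n-1}^{-q})²` on `[s₀, ∞)`, so
`Xₙ(t) ≤ (∑xₘ²)^{1/2} e^{-νλₙ²(s₁-s₀)} + K²λ_{n-1}^{β-2q}/(νλₙ²)` for `t ≥ s₁`.
[cite: BarbatoMorandinRomito2011, §3.1 Prop. 3.3 (proof) and §3.2] -/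
theorem IsBMRWeakSolution.decay_step (hX : IsBMRWeakSolution ν β x X) (hν : 0 < ν) (hβ : 0 < β)
    (hx : ∀ n, 1 ≤ n → 0 ≤ x n) (hx2 : Summable fun n => x n ^ 2)
    {q s₀ s₁ K : ℝ} (hs₀ : 0 ≤ s₀) (hs : s₀ < s₁)
    (hdec : ∀ n, 1 ≤ n → ∀ t, s₀ ≤ t → bmrLambda n ^ q * X n t ≤ K) :
    ∃ K' : ℝ, ∀ n, 1 ≤ n → ∀ t, s₁ ≤ t → bmrLambda n ^ (2 * q + 2 - β) * X n t ≤ K' := by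
  have hβ0 : β ≠ 0 := hβ.ne'
  set e : ℝ := 2 * q + 2 - β with he
  set Mx : ℝ := Real.sqrt (∑' k, x k ^ 2) with hMx
  have hMx0 : 0 ≤ Mx := Real.sqrt_nonneg _
  set d : ℝ := s₁ - s₀ with hd
  have hdpos : 0 < d := by rw [hd]; linarith
  set m : ℕ := ⌈e⌉₊ with hm
  have hqm : e ≤ m := Nat.le_ceil _
  refine ⟨(2 : ℝ) ^ e * K ^ 2 / (4 * ν) + Mx * ((m.factorial : ℝ) / (ν * d) ^ m),
    fun n hn t ht => ?_⟩
  have hXpos := hX.nonneg hβ0 hx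
  have hst : s₀ ≤ t := by linarith
  -- the feeding bound on `[s₀, ∞)`
  set Q : ℝ := bmrLambda (n - 1) ^ β * (K * bmrLambda (n - 1) ^ (-q)) ^ 2 with hQ
  have hQ0 : 0 ≤ Q := mul_nonneg (bmrLambda_rpow_nonneg _ _) (sq_nonneg _)
  have hfeed : ∀ τ, s₀ ≤ τ → bmrLambda (n - 1) ^ β * X (n - 1) τ ^ 2 ≤ Q := by
    intro τ hτ
    rcases Nat.lt_or_ge n 2 with hn1 | hn2
    · have : n = 1 := by omega
      subst this
      simp [hQ, Real.zero_rpow hβ0]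
    · have hpos : 0 ≤ X (n - 1) τ := hXpos (n - 1) (by omega) τ (hs₀.trans hτ)
      have hle : X (n - 1) τ ≤ K * bmrLambda (n - 1) ^ (-q) := by
        have h1 := hdec (n - 1) (by omega) τ hτ
        have hlpos : 0 < bmrLambda (n - 1) ^ q := Real.rpow_pos_of_pos (bmrLambda_pos (by omega)) q
        rw [Real.rpow_neg (bmrLambda_nonneg _), ← div_eq_mul_inv, le_div_iff₀ hlpos]
        linarith
      have hsq : X (n - 1) τ ^ 2 ≤ (K * bmrLambda (n - 1) ^ (-q)) ^ 2 :=
        pow_le_pow_left₀ hpos hle 2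
      exact mul_le_mul_of_nonneg_left hsq (bmrLambda_rpow_nonneg _ _)
  -- comparison for `g = Xₙ - Q/(νλₙ²)` on `[s₀, t]`
  have hln : 0 < bmrLambda n := bmrLambda_pos (by omega)
  set A : ℝ := ν * bmrLambda n ^ 2 with hA
  have hApos : 0 < A := by positivity
  set g : ℝ → ℝ := fun τ => X n τ - Q / A with hg
  have hgc : ContinuousOn g (Icc s₀ t) :=
    ((hX.continuousOn hn).mono fun τ hτ => hs₀.trans hτ.1).sub continuousOn_const
  have hgd : ∀ τ ∈ Ico s₀ t, HasDerivWithinAt g (bmrRHS ν β (fun k => X k τ) n) (Ici τ) τ := by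
    intro τ hτ
    have h := (hX.2 n hn τ (hs₀.trans hτ.1)).mono (Ici_subset_Ici.2 (hs₀.trans hτ.1))
    simpa [hg] using h.sub_const (Q / A)
  have hbound : ∀ τ ∈ Ico s₀ t, bmrRHS ν β (fun k => X k τ) n ≤ -A * g τ := by
    intro τ hτ
    have h1 := hfeed τ hτ.1
    have h2 : 0 ≤ bmrLambda n ^ β * X n τ * X (n + 1) τ :=
      mul_nonneg (mul_nonneg (bmrLambda_rpow_nonneg _ _) (hXpos n hn τ (hs₀.trans hτ.1)))
        (hXpos (n + 1) (by omega) τ (hs₀.trans hτ.1))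
    have hgA : -A * g τ = -A * X n τ + Q := by rw [hg]; field_simp; ring
    rw [hgA, bmrRHS, hA]
    linarith
  have hcomp := Literature.Analysis.ODE.le_mul_exp_of_deriv_right_le hgc hgd hbound t
    ⟨hst, le_rfl⟩
  -- `Xₙ(t) ≤ Mx e^{-A d} + Q/A`
  have hXle : X n t ≤ Mx * Real.exp (-(A * d)) + Q / A := by
    have hg0 : g s₀ ≤ Mx := by
      have := hX.le_sqrt_tsum hβ0 hν.le hx hx2 hn hs₀
      rw [hg]; dsimp only
      linarith [div_nonneg hQ0 hApos.le]
    have hexp_le : Real.exp (-A * (t - s₀)) ≤ Real.exp (-(A * d)) := by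
      apply Real.exp_le_exp.2; rw [hd]; nlinarith
    have hkey : g s₀ * Real.exp (-A * (t - s₀)) ≤ Mx * Real.exp (-(A * d)) := by
      rcases le_or_gt 0 (g s₀) with h0 | h0
      · exact mul_le_mul hg0 hexp_le (Real.exp_pos _).le hMx0
      · have : g s₀ * Real.exp (-A * (t - s₀)) ≤ 0 :=
          mul_nonpos_of_nonpos_of_nonneg h0.le (Real.exp_pos _).le
        exact this.trans (by positivity)
    have : X n t = g t + Q / A := by rw [hg]; ring
    rw [this]
    linarith
  -- multiply by the weight
  have hw0 : 0 ≤ bmrLambda n ^ e := bmrLambda_rpow_nonneg _ _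
  have hterm1 : bmrLambda n ^ e * (Mx * Real.exp (-(A * d))) ≤
      Mx * ((m.factorial : ℝ) / (ν * d) ^ m) := by
    have h := rpow_mul_exp_neg_le (one_le_bmrLambda (by omega : n ≠ 0)) (by positivity : 0 < ν * d) hqm
    have hAd : -(A * d) = -(ν * d * bmrLambda n ^ 2) := by rw [hA]; ring
    rw [hAd]
    calc bmrLambda n ^ e * (Mx * Real.exp (-(ν * d * bmrLambda n ^ 2)))
        = Mx * (bmrLambda n ^ e * Real.exp (-(ν * d * bmrLambda n ^ 2))) := by ring
      _ ≤ Mx * ((m.factorial : ℝ) / (ν * d) ^ m) := mul_le_mul_of_nonneg_left h hMx0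
  have hterm2 : bmrLambda n ^ e * (Q / A) ≤ (2 : ℝ) ^ e * K ^ 2 / (4 * ν) := by
    rcases Nat.lt_or_ge n 2 with hn1 | hn2
    · have : n = 1 := by omega
      subst this
      have hQz : Q = 0 := by simp [hQ, Real.zero_rpow hβ0]
      rw [hQz, zero_div, mul_zero]
      positivity
    · obtain ⟨k, rfl⟩ : ∃ k, n = k + 2 := ⟨n - 2, by omega⟩
      have hw := bootstrap_weights q β k
      rw [← he] at hw
      have : bmrLambda (k + 2) ^ e * (Q / A) =
          (2 : ℝ) ^ e * K ^ 2 / (4 * ν) := by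
        rw [hQ, hA, show k + 2 - 1 = k + 1 from rfl]
        field_simp
        linear_combination (K ^ 2) * hw
      rw [this]
  calc bmrLambda n ^ e * X n t
      ≤ bmrLambda n ^ e * (Mx * Real.exp (-(A * d)) + Q / A) :=
        mul_le_mul_of_nonneg_left hXle hw0
    _ = bmrLambda n ^ e * (Mx * Real.exp (-(A * d))) +
          bmrLambda n ^ e * (Q / A) := by ring
    _ ≤ _ := by linarith

/-- **Smoothing from a supercritical decay bound** (BMR §3.2: the first claim feeds the second,
and Prop. 3.3 then gives smoothness for `t > t₀`). If a weak solution with non-negative `ℓ²`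
datum (`ν > 0`, `β > 2`) satisfies `λₙ^{q₀} Xₙ(t) ≤ K` for all `n ≥ 1`, `t ≥ s₀`, with
`q₀ > β - 2`, then for every real `γ` and `t > s₀` there is `C` with `λₙ^γ Xₙ(t) ≤ C` for all
`n ≥ 1`. Proof: iterate `decay_step` along `q_{k+1} = 2q_k + 2 - β ≥ q_k + (q₀ - (β - 2))` on the
times `s₀ < … < t`. [cite: BarbatoMorandinRomito2011, §3.2 (proof of Thm. 1) and §3.1 Prop. 3.3] -/
theorem IsBMRWeakSolution.exists_rpow_mul_le_of_decay (hX : IsBMRWeakSolution ν β x X) (hν : 0 < ν)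
    (hβ : 2 < β) (hx : ∀ n, 1 ≤ n → 0 ≤ x n) (hx2 : Summable fun n => x n ^ 2)
    {q₀ s₀ K : ℝ} (hq₀ : β - 2 < q₀) (hs₀ : 0 ≤ s₀)
    (hdec : ∀ n, 1 ≤ n → ∀ t, s₀ ≤ t → bmrLambda n ^ q₀ * X n t ≤ K)
    (γ : ℝ) {t : ℝ} (ht : s₀ < t) :
    ∃ C : ℝ, ∀ n, 1 ≤ n → bmrLambda n ^ γ * X n t ≤ C := by
  have hβpos : 0 < β := by linarith
  -- the exponents
  set qs : ℕ → ℝ := fun k => Nat.rec q₀ (fun _ q => 2 * q + 2 - β) k with hqs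
  have hqs_succ : ∀ k, qs (k + 1) = 2 * qs k + 2 - β := fun k => rfl
  have hqs_zero : qs 0 = q₀ := rfl
  have hqs_ge : ∀ k, q₀ + k * (q₀ - (β - 2)) ≤ qs k := by
    intro k
    induction k with
    | zero => simp [hqs_zero]
    | succ k ih => rw [hqs_succ]; push_cast; nlinarith
  -- induction: a bound with exponent `qs k` from every time `s > s₀`
  have key : ∀ k : ℕ, ∀ s, s₀ < s → ∃ Kk : ℝ,
      ∀ n, 1 ≤ n → ∀ τ, s ≤ τ → bmrLambda n ^ qs k * X n τ ≤ Kk := by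
    intro k
    induction k with
    | zero =>
      intro s hs
      exact ⟨K, fun n hn τ hτ => hdec n hn τ (by linarith)⟩
    | succ k ih =>
      intro s hs
      obtain ⟨Kk, hKk⟩ := ih ((s₀ + s) / 2) (by linarith)
      obtain ⟨K', hK'⟩ := hX.decay_step hν hβpos hx hx2 (by linarith : (0 : ℝ) ≤ (s₀ + s) / 2)
        (by linarith : (s₀ + s) / 2 < s) hKk
      refine ⟨K', fun n hn τ hτ => ?_⟩
      rw [hqs_succ]
      exact hK' n hn τ hτ
  -- choose `k` with `qs k ≥ γ`
  obtain ⟨k, hk⟩ := exists_nat_ge ((γ - q₀) / (q₀ - (β - 2)))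
  have hγk : γ ≤ qs k := by
    have h1 := hqs_ge k
    have hpos : 0 < q₀ - (β - 2) := by linarith
    rw [div_le_iff₀ hpos] at hk
    linarith
  obtain ⟨Kk, hKk⟩ := key k t ht
  refine ⟨Kk, fun n hn => ?_⟩
  have hXn : 0 ≤ X n t := hX.nonneg hβpos.ne' hx n hn t (hs₀.trans ht.le)
  calc bmrLambda n ^ γ * X n t ≤ bmrLambda n ^ qs k * X n t :=
        mul_le_mul_of_nonneg_right
          (Real.rpow_le_rpow_of_exponent_le (one_le_bmrLambda (by omega)) hγk) hXn
    _ ≤ Kk := hKk n hn t le_rfl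

end

end Literature.Barriers.NavierStokesRegularity.Dyadic
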